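import Literature.NumberTheory.LFunctions.ChebyshevHalfLineBiasThm8RieszProofs
import Literature.NumberTheory.LFunctions.ChebyshevHalfLineBiasThm3Proofs
import Literature.Analysis.SpecialFunctions.DigammaReflection
import Literature.Analysis.SpecialFunctions.EulerMascheroniBounds
import Mathlib.Analysis.Calculus.Deriv.Star
import Mathlib.Analysis.Complex.ExponentialBounds
import Mathlib.Analysis.Real.Pi.Bounds
import HarnessLib

/-!
# `Re(L'/L)(½, χ) = ½[log(π/q) − ψ(¼ + κ/2)] ≠ 0` for primitive `χ` (Suzuki 2025, (4.6)) and Thm 8 clause (b), PROVED — «nothing here bears on the truth of RH»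

LINE 1 — LABEL: RH-FREE literature (unconditional special-value identities for Dirichlet `L`-functions at `s = ½`, two
numerical enclosures, and a kernel proof of the GRH-criterion clause (b) of Suzuki's Thm 8, whose hypothesis (4.2) is
itself GRH-implying). bears_on: LADDER-RH COLUMN 1 SCREW (S-C, criterion rung). WHAT THIS IS NOT: not a route, not
progress toward RH or GRH; nothing here bears on the truth of RH.

M. Suzuki, *On variants of Chebyshev's conjecture*, Ramanujan J. **68** (2025), no. 4, art. 95 = arXiv:2411.07436
[`Suzuki2025Chebyshev`; PUBLISHED, refereed], §4.1, proof of **Theorem 8**, AS PRINTED: «Finally, we prove that the sum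
(4.1) has a constant sign for all sufficiently large `x > 0` assuming `L(1/2) ≠ 0`, (4.2) and that `χ` is primitive.
Taking the logarithmic derivative of (2.11) and substituting `s = 1/2`, we obtain `Re(ξ'/ξ)(1/2, χ) = 0`. This gives
`Re(L'/L)(1/2) = ½[log(π/q) − (Γ'/Γ)(¼ + κ(χ)/2)]` (4.6) by (2.10). In particular, `Re(L'/L)(1/2)` depends only on `q`
and the parity of `χ`. By (4.6), the value `Re(L'/L)(1/2)` vanishes only when `q > 1` takes the following values
`q = π·exp[−(Γ'/Γ)(¼ + κ(χ)/2)] = 215.332⋯ (κ = 0), 9.305⋯ (κ = 1)`, however it is impossible for any integer `q > 1` …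
Hence `Re(L'/L)(1/2) ≠ 0`, and (4.5) implies that `f_χ(x)` has constant sign for sufficiently large `x > 0`.»

THIS FILE proves, for every primitive non-principal `χ` mod `q` with `L(½, χ) ≠ 0`:
* (4.6): `re_logDeriv_LFunction_half_of_even` / `_of_odd` — `Re(L'/L)(½, χ) = ½[log π − log q + γ ± π/2 + 3 log 2]`
  (`−ψ(¼) = γ + π/2 + 3 log 2`, `−ψ(¾) = γ − π/2 + 3 log 2`, Gauss's digamma values, the tree's
  `DigammaReflection.lean`), via `logDeriv_completedLFunction_add_inv` (the functional equation
  `Λ(1 − s, χ) = q^{s−½} ε(χ) Λ(s, χ̄)`, Mathlib's `IsPrimitive.completedLFunction_one_sub`, log-differentiated at `½`: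
  `(Λ'/Λ)(½, χ) + (Λ'/Λ)(½, χ̄) = −log q`), `logDeriv_LFunction_inv_half` (`(L'/L)(½, χ̄) = conj (L'/L)(½, χ)`, the
  tree's reflection `DirichletZFR.conj_LFunction_conj`), and the Gamma factor `(Γ_ℝ'/Γ_ℝ)(s) = −½ log π + ½ ψ(s/2)`
  (`hasDerivAt_Gammaℝ`, `logDeriv_gammaFactor_half_of_even/odd`; Mathlib's `gammaFactor`, `Gammaℝ`, `digamma`);
* the two numerical exclusions as kernel inequalities: `215 < 8π e^{γ+π/2} < 216` and `9 < 8π e^{γ−π/2} < 10`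
  (`π e^{−ψ(¼)} = 8π e^{γ+π/2}`, `π e^{−ψ(¾)} = 8π e^{γ−π/2}`; the tree's `γ ∈ (0.57721558, 0.57721571)`
  (`EulerMascheroniBounds.lean`), Mathlib's `π ∈ (3.141592, 3.141593)`, `e ∈ (2.7182818283, 2.7182818286)`, and the
  Taylor enclosures `Real.sum_le_exp_of_nonneg` / `Real.exp_bound'` with four terms), hence
  `re_logDeriv_LFunction_half_ne_zero`: `Re(L'/L)(½, χ) ≠ 0`;
* `Suzuki2025Chebyshev_thm8_clause_b` — VERBATIM the second conjunct of the named fact `Suzuki2025Chebyshev_thm8_limits`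
  (`ChebyshevHalfLineBiasCharacters.lean`): (4.2) ⟹ GRH (the tree's
  `DirichletHalfLineRiesz.riemannHypothesis_of_tendsto_rieszMean`, `ChebyshevHalfLineBiasThm8RieszProofs.lean`), GRH and
  `L(½, χ) ≠ 0` ⟹ (4.5) `f_χ(x) = −(L'/L)(½, χ) log x + O(1)` (the tree's
  `HalfLineRiesz.exists_norm_halfLineSum_add_le_of_GRH`, `ChebyshevHalfLineBiasCharExplicitFormula.lean`), and
  `Re(L'/L)(½, χ) ≠ 0` give the eventual constant sign of `Re f_χ(x) = Σ_{n ≤ x} Λ(n) Re χ(n)/√n · log(x/n)`.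
It does NOT discharge `Suzuki2025Chebyshev_thm8_limits` (clauses (a) «GRH ⟹ (4.2)» for imprimitive `χ` and (c)
«GRH ⟹ (4.2')», the order-`m` explicit formula, remain). Theorems only: no definitions, no named facts (D-0014/D-0026).

## References
* [Suzuki2025Chebyshev] M. Suzuki, Ramanujan J. 68 (2025) 95 = arXiv:2411.07436: §4.1 Thm 8, (4.1), (4.2), (4.5), (4.6)
  and the display following (4.6); §2 (2.10), (2.11).
* [AndrewsAskeyRoy1999] G. E. Andrews, R. Askey, R. Roy, *Special Functions*, CUP 1999, Thm 1.2.7 (Gauss's digamma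
  theorem; `ψ(¼)`, `ψ(¾)`) — the tree's `Literature/Analysis/SpecialFunctions/DigammaReflection.lean`.
-/

noncomputable section

open Complex Filter Topology Set ArithmeticFunction
open scoped Real ComplexConjugate

namespace Literature.NumberTheory.LFunctions

namespace DirichletLogDerivHalf

open Literature.Analysis.SpecialFunctions.Complex Literature.Analysis.SpecialFunctions.Real

variable {q : ℕ} [NeZero q] {χ : DirichletCharacter ℂ q}

/-! ## §1 The functional equation at `s = ½` and the reflection `L(s, χ̄) = conj L(s̄, χ)` -/

/-- A non-principal character has modulus `q > 1`. [folklore] -/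
private theorem one_lt_of_ne_one (hχ : χ ≠ 1) : 1 < q := by
  rcases Nat.lt_or_ge 1 q with h | h
  · exact h
  · exfalso
    interval_cases q
    · exact (NeZero.ne 0) rfl
    · exact hχ (χ.level_one' rfl)

/-- `Λ(½, χ) ≠ 0` when `L(½, χ) ≠ 0` (`L = Λ/γ`). [folklore] -/
private theorem completedLFunction_half_ne_zero (hhalf : χ.LFunction (1 / 2) ≠ 0) :
    χ.completedLFunction (1 / 2) ≠ 0 := by
  intro h0
  have hL := DirichletCharacter.LFunction_eq_completed_div_gammaFactor χ (1 / 2) (Or.inl (by norm_num))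
  rw [h0, zero_div] at hL
  exact hhalf hL

/-- **The functional equation, log-differentiated at `s = ½`**: for a primitive non-principal `χ` mod `q` with
`Λ(½, χ) ≠ 0`, `(Λ'/Λ)(½, χ) + (Λ'/Λ)(½, χ̄) = −log q`, from `Λ(1 − s, χ) = q^{s−½} ε(χ) Λ(s, χ̄)` (Mathlib's
`DirichletCharacter.IsPrimitive.completedLFunction_one_sub`).
[cite: Suzuki2025Chebyshev, §4.1, proof of (4.6) («Taking the logarithmic derivative of (2.11) and substituting s = 1/2»)] -/
theorem logDeriv_completedLFunction_add_inv (hprim : χ.IsPrimitive) (hχ : χ ≠ 1)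
    (hΛ : χ.completedLFunction (1 / 2) ≠ 0) :
    logDeriv χ.completedLFunction (1 / 2) + logDeriv χ⁻¹.completedLFunction (1 / 2) = -(Real.log q : ℂ) := by
  set Λ₁ := χ.completedLFunction with hΛ₁
  set Λ₂ := χ⁻¹.completedLFunction with hΛ₂
  have hχ' : χ⁻¹ ≠ 1 := inv_ne_one.mpr hχ
  have hq0 : (q : ℂ) ≠ 0 := by exact_mod_cast NeZero.ne q
  have hFE : ∀ s : ℂ, Λ₁ (1 - s) = (q : ℂ) ^ (s - 1 / 2) * χ.rootNumber * Λ₂ s := fun s ↦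
    hprim.completedLFunction_one_sub s
  have hhalf : Λ₁ (1 / 2) = χ.rootNumber * Λ₂ (1 / 2) := by
    have h := hFE (1 / 2)
    rwa [show (1 : ℂ) - 1 / 2 = 1 / 2 by norm_num, sub_self, Complex.cpow_zero, one_mul] at h
  have hε0 : χ.rootNumber ≠ 0 := fun h ↦ hΛ (by rw [hhalf, h, zero_mul])
  have hΛ₂0 : Λ₂ (1 / 2) ≠ 0 := fun h ↦ hΛ (by rw [hhalf, h, mul_zero])
  have hd₁ : Differentiable ℂ Λ₁ := DirichletCharacter.differentiable_completedLFunction hχ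
  have hd₂ : Differentiable ℂ Λ₂ := DirichletCharacter.differentiable_completedLFunction hχ'
  have h12 : (1 : ℂ) - 1 / 2 = 1 / 2 := by norm_num
  have hL1 : HasDerivAt (fun s : ℂ ↦ Λ₁ (1 - s)) (-deriv Λ₁ (1 / 2)) (1 / 2) := by
    have hd : HasDerivAt Λ₁ (deriv Λ₁ (1 / 2)) (1 - 1 / 2) := by
      rw [h12]; exact (hd₁ _).hasDerivAt
    have h := hd.comp (1 / 2 : ℂ) ((hasDerivAt_id (1 / 2 : ℂ)).const_sub 1)
    refine h.congr_deriv ?_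
    ring
  have hR1 : HasDerivAt (fun s : ℂ ↦ (q : ℂ) ^ (s - 1 / 2) * χ.rootNumber * Λ₂ s)
      ((q : ℂ) ^ ((1 / 2 : ℂ) - 1 / 2) * Complex.log q * 1 * χ.rootNumber * Λ₂ (1 / 2)
        + (q : ℂ) ^ ((1 / 2 : ℂ) - 1 / 2) * χ.rootNumber * deriv Λ₂ (1 / 2)) (1 / 2) := by
    have hc : HasDerivAt (fun s : ℂ ↦ (q : ℂ) ^ (s - 1 / 2)) ((q : ℂ) ^ ((1 / 2 : ℂ) - 1 / 2) * Complex.log q * 1)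
        (1 / 2) := ((hasDerivAt_id (1 / 2 : ℂ)).sub_const (1 / 2)).const_cpow (Or.inl hq0)
    exact (hc.mul_const χ.rootNumber).mul (hd₂ _).hasDerivAt
  have hfun : (fun s : ℂ ↦ Λ₁ (1 - s)) = fun s : ℂ ↦ (q : ℂ) ^ (s - 1 / 2) * χ.rootNumber * Λ₂ s :=
    funext hFE
  rw [hfun] at hL1
  have heq := hL1.unique hR1
  rw [sub_self, Complex.cpow_zero] at heq
  have hlogq : Complex.log q = (Real.log q : ℂ) := by
    rw [show (q : ℂ) = ((q : ℝ) : ℂ) by norm_cast, ← Complex.ofReal_log (Nat.cast_nonneg q)]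
  rw [hlogq] at heq
  rw [logDeriv_apply, logDeriv_apply, hhalf, div_add_div _ _ (mul_ne_zero hε0 hΛ₂0) hΛ₂0,
    div_eq_iff (mul_ne_zero (mul_ne_zero hε0 hΛ₂0) hΛ₂0)]
  linear_combination (-Λ₂ (1 / 2)) * heq

/-- **Reflection at `s = ½`**: `(L'/L)(½, χ̄) = conj (L'/L)(½, χ)` for `χ ≠ χ₀` (`L(s, χ̄) = conj L(s̄, χ)`, the tree's
`DirichletZFR.conj_LFunction_conj`, and Mathlib's `deriv_conj_conj`); the step «`Re(ξ'/ξ)(1/2, χ) = 0`» of the printed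
proof in the form used here. [cite: Suzuki2025Chebyshev, §4.1, proof of (4.6)] -/
theorem logDeriv_LFunction_inv_half (hχ : χ ≠ 1) :
    logDeriv χ⁻¹.LFunction (1 / 2) = conj (logDeriv χ.LFunction (1 / 2)) := by
  have hfun : χ⁻¹.LFunction = conj ∘ χ.LFunction ∘ conj := by
    funext s
    exact (DirichletZFR.conj_LFunction_conj χ hχ s).symm
  have h12 : conj (1 / 2 : ℂ) = 1 / 2 := by
    rw [map_div₀, map_one, map_ofNat]
  rw [logDeriv_apply, logDeriv_apply, hfun, deriv_conj_conj]
  simp only [Function.comp_apply]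
  rw [h12, ← map_div₀]

/-! ## §2 The Gamma factor: `(γ'/γ)(½, χ) = −½ log π + ½ ψ(¼ + κ/2)` -/

/-- `(Γ_ℝ'/Γ_ℝ)(s) = −½ log π + ½ ψ(s/2)` for `Re s > 0` (`Γ_ℝ(s) = π^{−s/2}Γ(s/2)`, the Archimedean factor of
`ξ(s, χ)` in (2.11)), together with differentiability. [cite: Suzuki2025Chebyshev, §2 (2.10)–(2.11)] -/
theorem hasDerivAt_Gammaℝ {s : ℂ} (hs : 0 < s.re) :
    DifferentiableAt ℂ Complex.Gammaℝ s ∧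
      deriv Complex.Gammaℝ s / Complex.Gammaℝ s = -(Real.log π : ℂ) / 2 + Complex.digamma (s / 2) / 2 := by
  have hG : Complex.Gammaℝ = fun s : ℂ ↦ (π : ℂ) ^ (-s / 2) * Complex.Gamma (s / 2) :=
    funext Complex.Gammaℝ_def
  have hπ : (π : ℂ) ≠ 0 := by exact_mod_cast Real.pi_ne_zero
  have hs2re : 0 < (s / 2).re := by
    rw [Complex.div_ofNat_re]
    positivity
  have hs2 : ∀ m : ℕ, s / 2 ≠ -m := fun m h ↦ by
    have h1 := congrArg Complex.re h
    rw [Complex.neg_re, Complex.natCast_re] at h1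
    have : (0 : ℝ) ≤ m := Nat.cast_nonneg m
    linarith
  have h1 : HasDerivAt (fun s : ℂ ↦ (π : ℂ) ^ (-s / 2)) ((π : ℂ) ^ (-s / 2) * Complex.log π * (-1 / 2)) s := by
    have hin : HasDerivAt (fun s : ℂ ↦ -s / 2) (-1 / 2) s := by
      have := ((hasDerivAt_id s).neg).div_const 2
      refine this.congr_deriv ?_
      ring
    exact hin.const_cpow (Or.inl hπ)
  have hΓd : DifferentiableAt ℂ Complex.Gamma (s / 2) := Complex.differentiableAt_Gamma _ hs2
  have h2 : HasDerivAt (fun s : ℂ ↦ Complex.Gamma (s / 2)) (deriv Complex.Gamma (s / 2) * (1 / 2)) s := by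
    have hin : HasDerivAt (fun s : ℂ ↦ s / 2) (1 / 2) s := by
      have := (hasDerivAt_id s).div_const 2
      refine this.congr_deriv ?_
      ring
    exact hΓd.hasDerivAt.comp s hin
  have hprod : HasDerivAt (fun s : ℂ ↦ (π : ℂ) ^ (-s / 2) * Complex.Gamma (s / 2))
      ((π : ℂ) ^ (-s / 2) * Complex.log π * (-1 / 2) * Complex.Gamma (s / 2) +
        (π : ℂ) ^ (-s / 2) * (deriv Complex.Gamma (s / 2) * (1 / 2))) s := h1.mul h2
  have hΓ0 : Complex.Gamma (s / 2) ≠ 0 := Complex.Gamma_ne_zero_of_re_pos hs2re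
  have hpow0 : (π : ℂ) ^ (-s / 2) ≠ 0 := by
    rw [Ne, Complex.cpow_eq_zero_iff, not_and_or]; exact Or.inl hπ
  have hlogπ : Complex.log π = (Real.log π : ℂ) := (Complex.ofReal_log Real.pi_pos.le).symm
  rw [hG]
  refine ⟨hprod.differentiableAt, ?_⟩
  rw [hprod.deriv]
  beta_reduce
  rw [Complex.digamma, logDeriv_apply, hlogπ]
  field_simp

omit [NeZero q] in
/-- The Gamma factors of `χ` and `χ̄` coincide (same parity). [folklore] -/
private theorem gammaFactor_inv (χ : DirichletCharacter ℂ q) : χ⁻¹.gammaFactor = χ.gammaFactor := by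
  funext s
  rcases χ.even_or_odd with h | h
  · have h' : χ⁻¹.Even := by
      show χ⁻¹ (-1) = 1
      rw [MulChar.inv_apply_eq_inv']
      rw [DirichletCharacter.Even] at h
      rw [h, inv_one]
    rw [h.gammaFactor_def, h'.gammaFactor_def]
  · have h' : χ⁻¹.Odd := by
      show χ⁻¹ (-1) = -1
      rw [MulChar.inv_apply_eq_inv']
      rw [DirichletCharacter.Odd] at h
      rw [h, inv_neg, inv_one]
    rw [h.gammaFactor_def, h'.gammaFactor_def]

omit [NeZero q] in
/-- Even `χ`: `γ(·, χ) = Γ_ℝ` is differentiable at `½` with `(γ'/γ)(½) = −½ log π + ½ ψ(¼)`.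
[cite: Suzuki2025Chebyshev, §4.1 (4.6) with (2.10), κ = 0] -/
theorem logDeriv_gammaFactor_half_of_even (heven : χ.Even) :
    DifferentiableAt ℂ χ.gammaFactor (1 / 2) ∧
      deriv χ.gammaFactor (1 / 2) / χ.gammaFactor (1 / 2) = -(Real.log π : ℂ) / 2 + Complex.digamma (1 / 4) / 2 := by
  have hG : χ.gammaFactor = Complex.Gammaℝ := funext heven.gammaFactor_def
  rw [hG, show (1 / 4 : ℂ) = (1 / 2) / 2 by norm_num]
  exact hasDerivAt_Gammaℝ (by norm_num)

omit [NeZero q] in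
/-- Odd `χ`: `γ(s, χ) = Γ_ℝ(s + 1)` is differentiable at `½` with `(γ'/γ)(½) = −½ log π + ½ ψ(¾)`.
[cite: Suzuki2025Chebyshev, §4.1 (4.6) with (2.10), κ = 1] -/
theorem logDeriv_gammaFactor_half_of_odd (hodd : χ.Odd) :
    DifferentiableAt ℂ χ.gammaFactor (1 / 2) ∧
      deriv χ.gammaFactor (1 / 2) / χ.gammaFactor (1 / 2) = -(Real.log π : ℂ) / 2 + Complex.digamma (3 / 4) / 2 := by
  have hG : χ.gammaFactor = fun s ↦ Complex.Gammaℝ (s + 1) := funext hodd.gammaFactor_def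
  obtain ⟨hd, hval⟩ := hasDerivAt_Gammaℝ (s := 1 / 2 + 1) (by norm_num)
  rw [hG, deriv_comp_add_const, show (3 / 4 : ℂ) = (1 / 2 + 1) / 2 by norm_num]
  exact ⟨hd.comp (1 / 2 : ℂ) (differentiableAt_id.add_const 1), hval⟩

/-! ## §3 Suzuki's (4.6): `Re(L'/L)(½, χ) = ½[log(π/q) − ψ(¼ + κ(χ)/2)]` -/

/-- **(4.6), complex form**: for a primitive non-principal `χ` mod `q` with `L(½, χ) ≠ 0`, if
`(γ'/γ)(½, χ) = −½ log π + ½ψ_a` then `(L'/L)(½, χ) + conj (L'/L)(½, χ) = −log q + log π − ψ_a`, i.e.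
`2 Re(L'/L)(½, χ) = log(π/q) − ψ(¼ + κ/2)` (`L = Λ/γ` for `χ` and `χ̄`, §1, §2). [cite: Suzuki2025Chebyshev, §4.1 (4.6)] -/
theorem logDeriv_LFunction_half_add_conj (hprim : χ.IsPrimitive) (hχ : χ ≠ 1)
    (hhalf : χ.LFunction (1 / 2) ≠ 0) {ψa : ℂ}
    (hγ : DifferentiableAt ℂ χ.gammaFactor (1 / 2) ∧
      deriv χ.gammaFactor (1 / 2) / χ.gammaFactor (1 / 2) = -(Real.log π : ℂ) / 2 + ψa / 2) :
    logDeriv χ.LFunction (1 / 2) + conj (logDeriv χ.LFunction (1 / 2)) =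
      -(Real.log q : ℂ) + (Real.log π : ℂ) - ψa := by
  obtain ⟨hdγ, hγval⟩ := hγ
  have hχ' : χ⁻¹ ≠ 1 := inv_ne_one.mpr hχ
  have hq1 : q ≠ 1 := (one_lt_of_ne_one hχ).ne'
  have hΛ₁ : χ.completedLFunction (1 / 2) ≠ 0 := completedLFunction_half_ne_zero hhalf
  -- `L(½, χ̄) = conj L(½, χ) ≠ 0`, hence `Λ(½, χ̄) ≠ 0`
  have hhalf' : χ⁻¹.LFunction (1 / 2) ≠ 0 := by
    rw [← DirichletZFR.conj_LFunction_conj χ hχ (1 / 2), map_ne_zero,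
      show conj (1 / 2 : ℂ) = 1 / 2 by rw [map_div₀, map_one, map_ofNat]]
    exact hhalf
  have hΛ₂ : χ⁻¹.completedLFunction (1 / 2) ≠ 0 := completedLFunction_half_ne_zero hhalf'
  have hγ0 : χ.gammaFactor (1 / 2) ≠ 0 := SiegelZero.gammaFactor_ne_zero_of_re_pos χ (by norm_num)
  -- `L = Λ/γ` for `χ` and for `χ̄`
  have hfun₁ : χ.LFunction = fun s ↦ χ.completedLFunction s / χ.gammaFactor s := by
    funext s
    exact DirichletCharacter.LFunction_eq_completed_div_gammaFactor χ s (Or.inr hq1)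
  have hfun₂ : χ⁻¹.LFunction = fun s ↦ χ⁻¹.completedLFunction s / χ.gammaFactor s := by
    funext s
    rw [← gammaFactor_inv χ]
    exact DirichletCharacter.LFunction_eq_completed_div_gammaFactor χ⁻¹ s (Or.inr hq1)
  have hdΛ₁ : DifferentiableAt ℂ χ.completedLFunction (1 / 2) :=
    DirichletCharacter.differentiable_completedLFunction hχ _
  have hdΛ₂ : DifferentiableAt ℂ χ⁻¹.completedLFunction (1 / 2) :=
    DirichletCharacter.differentiable_completedLFunction hχ' _
  have h₁ : logDeriv χ.LFunction (1 / 2) =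
      logDeriv χ.completedLFunction (1 / 2) - deriv χ.gammaFactor (1 / 2) / χ.gammaFactor (1 / 2) := by
    rw [hfun₁, logDeriv_div (1 / 2 : ℂ) hΛ₁ hγ0 hdΛ₁ hdγ]
    simp only [logDeriv_apply]
  have h₂ : logDeriv χ⁻¹.LFunction (1 / 2) =
      logDeriv χ⁻¹.completedLFunction (1 / 2) - deriv χ.gammaFactor (1 / 2) / χ.gammaFactor (1 / 2) := by
    rw [hfun₂, logDeriv_div (1 / 2 : ℂ) hΛ₂ hγ0 hdΛ₂ hdγ]
    simp only [logDeriv_apply]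
  have hFE := logDeriv_completedLFunction_add_inv hprim hχ hΛ₁
  rw [← logDeriv_LFunction_inv_half hχ, h₁, h₂, hγval]
  linear_combination hFE

/-- **(4.6), even primitive `χ` (`κ = 0`)**: `Re(L'/L)(½, χ) = ½[log π − log q + γ + π/2 + 3 log 2]`
(`ψ(¼) = −γ − π/2 − 3 log 2`, Gauss; the tree's `digamma_one_quarter_eq_neg_ofReal`).
[cite: Suzuki2025Chebyshev, §4.1 (4.6), κ(χ) = 0] -/
theorem re_logDeriv_LFunction_half_of_even (hprim : χ.IsPrimitive) (hχ : χ ≠ 1)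
    (hhalf : χ.LFunction (1 / 2) ≠ 0) (heven : χ.Even) :
    (logDeriv χ.LFunction (1 / 2)).re =
      (Real.log π - Real.log q + Real.eulerMascheroniConstant + π / 2 + 3 * Real.log 2) / 2 := by
  have h := logDeriv_LFunction_half_add_conj hprim hχ hhalf (logDeriv_gammaFactor_half_of_even heven)
  rw [Complex.add_conj, digamma_one_quarter_eq_neg_ofReal] at h
  have h' : ((2 * (logDeriv χ.LFunction (1 / 2)).re : ℝ) : ℂ) =
      ((-Real.log q + Real.log π + (Real.eulerMascheroniConstant + Real.pi / 2 + 3 * Real.log 2) : ℝ) : ℂ) := by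
    rw [h]; push_cast; ring
  have h'' := Complex.ofReal_injective h'
  linarith

/-- **(4.6), odd primitive `χ` (`κ = 1`)**: `Re(L'/L)(½, χ) = ½[log π − log q + γ − π/2 + 3 log 2]`
(`ψ(¾) = −γ + π/2 − 3 log 2`, Gauss; the tree's `digamma_three_quarters`).
[cite: Suzuki2025Chebyshev, §4.1 (4.6), κ(χ) = 1] -/
theorem re_logDeriv_LFunction_half_of_odd (hprim : χ.IsPrimitive) (hχ : χ ≠ 1)
    (hhalf : χ.LFunction (1 / 2) ≠ 0) (hodd : χ.Odd) :
    (logDeriv χ.LFunction (1 / 2)).re =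
      (Real.log π - Real.log q + Real.eulerMascheroniConstant - π / 2 + 3 * Real.log 2) / 2 := by
  have h := logDeriv_LFunction_half_add_conj hprim hχ hhalf (logDeriv_gammaFactor_half_of_odd hodd)
  have h34 : Complex.digamma (3 / 4) =
      ((-Real.eulerMascheroniConstant + Real.pi / 2 - 3 * Real.log 2 : ℝ) : ℂ) := by
    rw [digamma_three_quarters]
    push_cast
    rw [Complex.ofReal_log zero_le_two]
    push_cast
    ring
  rw [Complex.add_conj, h34] at h
  have h' : ((2 * (logDeriv χ.LFunction (1 / 2)).re : ℝ) : ℂ) =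
      ((-Real.log q + Real.log π - (-Real.eulerMascheroniConstant + Real.pi / 2 - 3 * Real.log 2) : ℝ) : ℂ) := by
    rw [h]; push_cast; ring
  have h'' := Complex.ofReal_injective h'
  linarith

/-! ## §4 The two numerical exclusions: `8π e^{γ+π/2} ∈ (215, 216)` and `8π e^{γ−π/2} ∈ (9, 10)` -/

/-- `215 < 8π e^{γ + π/2} (= π e^{−ψ(¼)} = 215.33…)`. [cite: Suzuki2025Chebyshev, §4.1, display after (4.6) («215.332⋯, κ = 0»)] -/
theorem lt_eight_pi_exp_even : (215 : ℝ) < 8 * π * Real.exp (Real.eulerMascheroniConstant + π / 2) := by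
  have hγ := eulerMascheroniConstant_gt_d8
  have hπ := Real.pi_gt_d6
  have he := Real.exp_one_gt_d9
  set y : ℝ := Real.eulerMascheroniConstant + π / 2 - 2 with hy
  have hy0 : (0.14801158 : ℝ) ≤ y := by rw [hy]; linarith
  have hsplit : Real.exp (Real.eulerMascheroniConstant + π / 2) = Real.exp 1 ^ 2 * Real.exp y := by
    rw [← Real.exp_nat_mul, ← Real.exp_add]
    congr 1
    rw [hy]; push_cast; ring
  have h4 : (1 + 0.14801158 + 0.14801158 ^ 2 / 2 + 0.14801158 ^ 3 / 6 : ℝ) ≤ Real.exp 0.14801158 := by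
    have h := Real.sum_le_exp_of_nonneg (by norm_num : (0 : ℝ) ≤ 0.14801158) 4
    simp only [Finset.sum_range_succ, Finset.sum_range_zero, Nat.factorial] at h
    norm_num at h ⊢
    linarith
  have hey : Real.exp 0.14801158 ≤ Real.exp y := Real.exp_le_exp.2 hy0
  rw [hsplit, ← mul_assoc]
  calc (215 : ℝ) < 8 * 3.141592 * 2.7182818283 ^ 2 *
      (1 + 0.14801158 + 0.14801158 ^ 2 / 2 + 0.14801158 ^ 3 / 6 : ℝ) := by norm_num
    _ ≤ 8 * π * Real.exp 1 ^ 2 * Real.exp y := by gcongr; exact h4.trans hey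

/-- `8π e^{γ + π/2} < 216`. [cite: Suzuki2025Chebyshev, §4.1, display after (4.6) («215.332⋯, κ = 0»)] -/
theorem eight_pi_exp_even_lt : 8 * π * Real.exp (Real.eulerMascheroniConstant + π / 2) < (216 : ℝ) := by
  have hγ := eulerMascheroniConstant_lt_d8
  have hπ := Real.pi_lt_d6
  have he := Real.exp_one_lt_d9
  set y : ℝ := Real.eulerMascheroniConstant + π / 2 - 2 with hy
  have hy1 : y ≤ (0.14801221 : ℝ) := by rw [hy]; linarith
  have hy0 : 0 ≤ y := by
    rw [hy]; linarith [eulerMascheroniConstant_gt_d8, Real.pi_gt_d6]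
  have hsplit : Real.exp (Real.eulerMascheroniConstant + π / 2) = Real.exp 1 ^ 2 * Real.exp y := by
    rw [← Real.exp_nat_mul, ← Real.exp_add]
    congr 1
    rw [hy]; push_cast; ring
  have h4 : Real.exp 0.14801221 ≤ (1 + 0.14801221 + 0.14801221 ^ 2 / 2 + 0.14801221 ^ 3 / 6 +
      0.14801221 ^ 4 * 5 / 96 : ℝ) := by
    have h := Real.exp_bound' (by norm_num : (0 : ℝ) ≤ 0.14801221) (by norm_num : (0.14801221 : ℝ) ≤ 1)
      (n := 4) (by norm_num)
    simp only [Finset.sum_range_succ, Finset.sum_range_zero, Nat.factorial] at h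
    norm_num at h ⊢
    linarith
  have hey : Real.exp y ≤ Real.exp 0.14801221 := Real.exp_le_exp.2 hy1
  rw [hsplit, ← mul_assoc]
  calc 8 * π * Real.exp 1 ^ 2 * Real.exp y ≤ 8 * 3.141593 * 2.7182818286 ^ 2 *
      (1 + 0.14801221 + 0.14801221 ^ 2 / 2 + 0.14801221 ^ 3 / 6 + 0.14801221 ^ 4 * 5 / 96 : ℝ) := by
        gcongr
        exact hey.trans h4
    _ < 216 := by norm_num

/-- `9 < 8π e^{γ − π/2} (= π e^{−ψ(¾)} = 9.305…)`. [cite: Suzuki2025Chebyshev, §4.1, display after (4.6) («9.305⋯, κ = 1»)] -/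
theorem lt_eight_pi_exp_odd : (9 : ℝ) < 8 * π * Real.exp (Real.eulerMascheroniConstant - π / 2) := by
  have hγ := eulerMascheroniConstant_gt_d8
  have hπ := Real.pi_lt_d6
  have hπ' := Real.pi_gt_d6
  set t : ℝ := π / 2 - Real.eulerMascheroniConstant with ht
  have ht1 : t ≤ (0.99358092 : ℝ) := by rw [ht]; linarith
  have ht0 : 0 ≤ t := by rw [ht]; linarith [eulerMascheroniConstant_lt_d8]
  have hsplit : Real.exp (Real.eulerMascheroniConstant - π / 2) = (Real.exp t)⁻¹ := by
    rw [← Real.exp_neg]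
    congr 1
    rw [ht]; ring
  have h4 : Real.exp 0.99358092 ≤ (1 + 0.99358092 + 0.99358092 ^ 2 / 2 + 0.99358092 ^ 3 / 6 +
      0.99358092 ^ 4 * 5 / 96 : ℝ) := by
    have h := Real.exp_bound' (by norm_num : (0 : ℝ) ≤ 0.99358092) (by norm_num : (0.99358092 : ℝ) ≤ 1)
      (n := 4) (by norm_num)
    simp only [Finset.sum_range_succ, Finset.sum_range_zero, Nat.factorial] at h
    norm_num at h ⊢
    linarith
  have het : Real.exp t ≤ Real.exp 0.99358092 := Real.exp_le_exp.2 ht1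
  have hE : Real.exp t ≤ (1 + 0.99358092 + 0.99358092 ^ 2 / 2 + 0.99358092 ^ 3 / 6 +
      0.99358092 ^ 4 * 5 / 96 : ℝ) := het.trans h4
  rw [hsplit]
  have hpos : 0 < Real.exp t := Real.exp_pos t
  rw [lt_mul_inv_iff₀ hpos]
  calc 9 * Real.exp t ≤ 9 * (1 + 0.99358092 + 0.99358092 ^ 2 / 2 + 0.99358092 ^ 3 / 6 +
      0.99358092 ^ 4 * 5 / 96 : ℝ) := by gcongr
    _ < 8 * 3.141592 := by norm_num
    _ ≤ 8 * π := by gcongr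

/-- `8π e^{γ − π/2} < 10`. [cite: Suzuki2025Chebyshev, §4.1, display after (4.6) («9.305⋯, κ = 1»)] -/
theorem eight_pi_exp_odd_lt : 8 * π * Real.exp (Real.eulerMascheroniConstant - π / 2) < (10 : ℝ) := by
  have hγ := eulerMascheroniConstant_lt_d8
  have hπ := Real.pi_lt_d6
  have hπ' := Real.pi_gt_d6
  set t : ℝ := π / 2 - Real.eulerMascheroniConstant with ht
  have ht0 : (0.99358029 : ℝ) ≤ t := by rw [ht]; linarith
  have hsplit : Real.exp (Real.eulerMascheroniConstant - π / 2) = (Real.exp t)⁻¹ := by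
    rw [← Real.exp_neg]
    congr 1
    rw [ht]; ring
  have h4 : (1 + 0.99358029 + 0.99358029 ^ 2 / 2 + 0.99358029 ^ 3 / 6 : ℝ) ≤ Real.exp 0.99358029 := by
    have h := Real.sum_le_exp_of_nonneg (by norm_num : (0 : ℝ) ≤ 0.99358029) 4
    simp only [Finset.sum_range_succ, Finset.sum_range_zero, Nat.factorial] at h
    norm_num at h ⊢
    linarith
  have het : Real.exp 0.99358029 ≤ Real.exp t := Real.exp_le_exp.2 ht0
  have hE : (1 + 0.99358029 + 0.99358029 ^ 2 / 2 + 0.99358029 ^ 3 / 6 : ℝ) ≤ Real.exp t := h4.trans het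
  rw [hsplit]
  have hpos : 0 < Real.exp t := Real.exp_pos t
  rw [mul_inv_lt_iff₀ hpos]
  calc 8 * π ≤ 8 * 3.141593 := by gcongr
    _ < 10 * (1 + 0.99358029 + 0.99358029 ^ 2 / 2 + 0.99358029 ^ 3 / 6 : ℝ) := by norm_num
    _ ≤ 10 * Real.exp t := by gcongr

/-! ## §5 `Re(L'/L)(½, χ) ≠ 0` for every primitive non-principal `χ` with `L(½, χ) ≠ 0` -/

/-- `exp(log π + γ ± π/2 + 3 log 2) = 8π e^{γ ± π/2}`. [folklore] -/
private theorem exp_const_eq (c : ℝ) :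
    Real.exp (Real.log π + c + 3 * Real.log 2) = 8 * π * Real.exp c := by
  rw [Real.exp_add, Real.exp_add, Real.exp_log Real.pi_pos, show (3 : ℝ) = ((3 : ℕ) : ℝ) by norm_num,
    Real.exp_nat_mul, Real.exp_log two_pos]
  norm_num
  ring

/-- **`Re(L'/L)(½, χ) ≠ 0`** for a primitive non-principal `χ` mod `q` with `L(½, χ) ≠ 0`: by (4.6) it vanishes only if
`q = π·exp[−ψ(¼ + κ/2)]`, `= 215.332…` (`κ = 0`) or `= 9.305…` (`κ = 1`), «however it is impossible for any integer
`q > 1`». [cite: Suzuki2025Chebyshev, §4.1, (4.6) and the display following it] -/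
theorem re_logDeriv_LFunction_half_ne_zero (hprim : χ.IsPrimitive) (hχ : χ ≠ 1)
    (hhalf : χ.LFunction (1 / 2) ≠ 0) : (logDeriv χ.LFunction (1 / 2)).re ≠ 0 := by
  have hq0 : (0 : ℝ) < q := by exact_mod_cast Nat.pos_of_ne_zero (NeZero.ne q)
  intro h0
  rcases χ.even_or_odd with heven | hodd
  · rw [re_logDeriv_LFunction_half_of_even hprim hχ hhalf heven] at h0
    have hlog : Real.log q = Real.log π + (Real.eulerMascheroniConstant + π / 2) + 3 * Real.log 2 := by
      linarith
    have hq : (q : ℝ) = 8 * π * Real.exp (Real.eulerMascheroniConstant + π / 2) := by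
      rw [← exp_const_eq, ← hlog, Real.exp_log hq0]
    have h1 := lt_eight_pi_exp_even
    have h2 := eight_pi_exp_even_lt
    rw [← hq] at h1 h2
    have h1' : 215 < q := by exact_mod_cast h1
    have h2' : q < 216 := by exact_mod_cast h2
    omega
  · rw [re_logDeriv_LFunction_half_of_odd hprim hχ hhalf hodd] at h0
    have hlog : Real.log q = Real.log π + (Real.eulerMascheroniConstant - π / 2) + 3 * Real.log 2 := by
      linarith
    have hq : (q : ℝ) = 8 * π * Real.exp (Real.eulerMascheroniConstant - π / 2) := by
      rw [← exp_const_eq, ← hlog, Real.exp_log hq0]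
    have h1 := lt_eight_pi_exp_odd
    have h2 := eight_pi_exp_odd_lt
    rw [← hq] at h1 h2
    have h1' : 9 < q := by exact_mod_cast h1
    have h2' : q < 10 := by exact_mod_cast h2
    omega

/-! ## §6 Thm 8, clause (b): `χ` primitive, `L(½, χ) ≠ 0`, (4.2) ⟹ the sign of `Re f_χ(x)` is eventually constant -/

omit [NeZero q] in
/-- `Re f_χ(x) = Σ_{n ≤ x} Λ(n) Re χ(n)/√n · log(x/n)`. [folklore] -/
private theorem re_halfLineSum (χ : DirichletCharacter ℂ q) (x : ℝ) :
    (HalfLineRiesz.halfLineSum χ x).re =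
      ∑ n ∈ Finset.Icc 1 ⌊x⌋₊, Λ n * (χ (n : ZMod q)).re / Real.sqrt n * Real.log (x / n) := by
  rw [HalfLineRiesz.halfLineSum, Complex.re_sum]
  refine Finset.sum_congr rfl fun n _ ↦ ?_
  have h1 : (Λ n : ℂ) * χ (n : ZMod q) / (Real.sqrt n : ℂ) * (Real.log (x / n) : ℂ) =
      ((Λ n / Real.sqrt n * Real.log (x / n) : ℝ) : ℂ) * χ (n : ZMod q) := by
    push_cast
    ring
  rw [h1, Complex.re_ofReal_mul]
  ring

/-- **Suzuki 2025, Thm 8, clause (b), PROVED** — verbatim the second conjunct of the named fact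
`Suzuki2025Chebyshev_thm8_limits`: for a primitive non-principal `χ` mod `q` with `L(½, χ) ≠ 0`, if the Riesz mean (4.2)
converges to `−(L'/L)(½, χ)`, then `Σ_{n ≤ x} Λ(n) Re χ(n)/√n · log(x/n)` has a constant sign for all large `x`. Printed
proof: (4.2) ⟹ GRH (`DirichletHalfLineRiesz.riemannHypothesis_of_tendsto_rieszMean`); under GRH, (4.5) gives
`f_χ(x) = −(L'/L)(½, χ) log x + O(1)` (`HalfLineRiesz.exists_norm_halfLineSum_add_le_of_GRH`); and `Re(L'/L)(½, χ) ≠ 0`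
by (4.6) (`re_logDeriv_LFunction_half_ne_zero`), so `Re f_χ(x) = −Re(L'/L)(½, χ)·log x + O(1)` has the sign of
`−Re(L'/L)(½, χ)` for all large `x`. [cite: Suzuki2025Chebyshev, §4.1 Thm 8 (second half: «if we further assume that χ is
primitive, the sum (4.1) has a constant sign for all sufficiently large x > 0 under (4.2)») with (4.5), (4.6)] -/
theorem Suzuki2025Chebyshev_thm8_clause_b :
    ∀ (q : ℕ) [NeZero q] (χ : DirichletCharacter ℂ q), χ ≠ 1 → χ.IsPrimitive → χ.LFunction (1 / 2) ≠ 0 →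
    Tendsto (fun x : ℝ ↦ ∑ n ∈ Finset.Icc 1 ⌊x⌋₊,
        (Λ n : ℂ) * χ (n : ZMod q) / (Real.sqrt n : ℂ) * ((1 - Real.log n / Real.log x : ℝ) : ℂ))
      atTop (𝓝 (-logDeriv χ.LFunction (1 / 2))) →
    ∃ x₀ : ℝ,
      (∀ x : ℝ, x₀ ≤ x →
          0 ≤ ∑ n ∈ Finset.Icc 1 ⌊x⌋₊, Λ n * (χ (n : ZMod q)).re / Real.sqrt n * Real.log (x / n)) ∨
      (∀ x : ℝ, x₀ ≤ x →
          ∑ n ∈ Finset.Icc 1 ⌊x⌋₊, Λ n * (χ (n : ZMod q)).re / Real.sqrt n * Real.log (x / n) ≤ 0) := by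
  intro q _ χ hχ hprim hhalf hlim
  have hGRH := DirichletHalfLineRiesz.riemannHypothesis_of_tendsto_rieszMean hχ hlim
  have hq : 1 < q := one_lt_of_ne_one hχ
  obtain ⟨B, hB⟩ := HalfLineRiesz.exists_norm_halfLineSum_add_le_of_GRH hprim hq hhalf hGRH
  set r : ℝ := (logDeriv χ.LFunction (1 / 2)).re with hr_def
  have hr : r ≠ 0 := re_logDeriv_LFunction_half_ne_zero hprim hχ hhalf
  have hkey : ∀ x : ℝ, 1 < x →
      |(∑ n ∈ Finset.Icc 1 ⌊x⌋₊, Λ n * (χ (n : ZMod q)).re / Real.sqrt n * Real.log (x / n))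
        + Real.log x * r| ≤ B := by
    intro x hx
    have h := hB x hx
    have hre : (HalfLineRiesz.halfLineSum χ x +
        (Real.log x : ℂ) * (deriv χ.LFunction (1 / 2) / χ.LFunction (1 / 2))).re =
        (∑ n ∈ Finset.Icc 1 ⌊x⌋₊, Λ n * (χ (n : ZMod q)).re / Real.sqrt n * Real.log (x / n))
          + Real.log x * r := by
      rw [Complex.add_re, re_halfLineSum, Complex.re_ofReal_mul, ← logDeriv_apply]
    rw [← hre]
    exact (Complex.abs_re_le_norm _).trans h
  rcases lt_or_gt_of_ne hr with hneg | hpos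
  · -- `Re(L'/L)(½, χ) < 0`: the sum is eventually `≥ 0`
    refine ⟨max 2 (Real.exp (B / (-r))), Or.inl fun x hx ↦ ?_⟩
    have hx1 : 1 < x := by linarith [le_max_left 2 (Real.exp (B / (-r)))]
    have hlog : B / (-r) ≤ Real.log x := by
      rw [← Real.log_exp (B / (-r))]
      exact Real.log_le_log (Real.exp_pos _) (le_trans (le_max_right _ _) hx)
    have hB' : B ≤ Real.log x * (-r) := by rwa [div_le_iff₀ (neg_pos.2 hneg)] at hlog
    have h1 := (abs_le.1 (hkey x hx1)).1
    linarith
  · -- `Re(L'/L)(½, χ) > 0`: the sum is eventually `≤ 0`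
    refine ⟨max 2 (Real.exp (B / r)), Or.inr fun x hx ↦ ?_⟩
    have hx1 : 1 < x := by linarith [le_max_left 2 (Real.exp (B / r))]
    have hlog : B / r ≤ Real.log x := by
      rw [← Real.log_exp (B / r)]
      exact Real.log_le_log (Real.exp_pos _) (le_trans (le_max_right _ _) hx)
    have hB' : B ≤ Real.log x * r := by rwa [div_le_iff₀ hpos] at hlog
    have h1 := (abs_le.1 (hkey x hx1)).2
    linarith

end DirichletLogDerivHalf

end Literature.NumberTheory.LFunctions

end
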